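import Literature.Analysis.FluidPDE.NSLerayHopfSereginEnergyProofs
import Literature.Analysis.FluidPDE.KatoFarFieldBound
import Literature.Analysis.FluidPDE.NSLerayExistenceR3Holds
import Literature.Analysis.FluidPDE.LerayLocalRegularH1Proofs
import Literature.Analysis.FluidPDE.RusinSverakLeraySolutions
import Literature.Analysis.FluidPDE.H1ContinuationSobolevClass
import Summits.NavierStokesRegularity.NavierStokesRegularity.Theorems.TypeICertificateLadderNoBlowupToClayLemmas

/-!
# Crux `CertifiedBlowupAxisymBlowup` (stmt-NavierStokesRegularity-0727), line `compact-amplification`: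
# structure of a maximal Leray–Hopf classical solution below its lifespan

Theorems file (lands `--supports stmt-NavierStokesRegularity-0727`), first half of the CONVERSE of
the line's transfer (crux ⇒ C⁺, which shows that the open stub `stub_amplification` is EQUIVALENT
to the crux, not a strengthening of it). For a maximal smooth solution `(u, p)` of the unforced
Navier–Stokes system on `ℝ³ × [0, T)` (`IsMaximalSmoothSolution ν 0 u p T`) which is Leray–Hopf on
`[0, T]` from a rapidly decaying datum `u 0`:

* `ofReal_le_katoMaximalTime_of_isMaximalSmoothSolution`: the Kato maximal time of `u 0` is at
  least `T` — otherwise the maximal Kato solution has a singular point `(T_max, x₁)` with `T_max < T`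
  (Lemarié-Rieusset 2016, Thm. 15.1 (C)), while it agrees a.e. with `u` (Prodi–Serrin through the
  Tao-class upgrades of the Kato solution, von Wahl), and `u` is smooth, hence bounded, near
  `(T_max, x₁)`;
* `exists_isTaoSolutionOn_of_isMaximalSmoothSolution`: consequently, for every `0 < t < T` the datum
  `u 0` has a Tao-class solution on the closed slab `[0, t]`, and it coincides with `u` there
  (weak–strong uniqueness and continuity of the slices);
* `exists_enstrophy_gt_of_isMaximalSmoothSolution`: the enstrophy `∫ ‖∇u(t)‖²` is unbounded on
  `[0, T)` — otherwise the `H¹` continuation criterion (`hasSobolevExtensionPast_of_uniform_H1_bound`,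
  Constantin–Fefferman / Lemarié-Rieusset Thm. 11.7) continues `u` smoothly past `T`.

All engines are proved theorems of the tree (Kato maximal time and its singular point, von Wahl's
upgrade `exists_isTaoSolutionOn_of_isKatoSolutionOn`, `weak_strong_uniqueness_holds`,
`hasSobolevExtensionPast_of_uniform_H1_bound`).

## References

* P. G. Lemarié-Rieusset, *The Navier–Stokes Problem in the 21st Century*, CRC 2016, Thm. 7.2,
  Thm. 11.7, Prop. 12.3, Thm. 15.1 (C).
* J. C. Robinson, J. L. Rodrigo, W. Sadowski, *The Three-Dimensional Navier–Stokes Equations*,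
  CUP 2016, Thm. 8.19.
* T. Tao, Anal. PDE 6 (2013) = arXiv:1108.1165, Thm. 5.4.
-/

set_option linter.dupNamespace false

noncomputable section

open MeasureTheory Set Function Filter Topology Metric
open scoped ENNReal NNReal ContDiff InnerProductSpace RealInnerProductSpace Laplacian

namespace Summit.NavierStokesRegularity.NavierStokesRegularity.Theorems.CertifiedBlowupAxisymBlowup.CompactAmplification

open Literature.Analysis.FluidPDE

local notation "ℝ³" => EuclideanSpace ℝ (Fin 3)

/-- A smooth rapidly decaying divergence-free field on `ℝ³` is in `L²`, in `L³`, and weakly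
divergence free (the Clay datum seen in the classes of Leray's and Kato's theories). [folklore] -/
theorem amplificationOf_datum {u₀ : ℝ³ → ℝ³} (hsm : ContDiff ℝ ∞ u₀)
    (hdiv : VectorCalculus.IsDivFree u₀) (hdec : HasRapidSpatialDecay u₀) :
    MemLp u₀ 2 volume ∧ MemLp u₀ 3 volume ∧ IsWeaklyDivFree u₀ := by
  have hHk : ∀ n : ℕ, ∫⁻ x, ‖iteratedFDeriv ℝ n u₀ x‖ₑ ^ 2 < ⊤ :=
    hdec.lintegral_enorm_iteratedFDeriv_sq_lt_top
  have hmeas0 : AEStronglyMeasurable u₀ volume := hsm.continuous.aestronglyMeasurable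
  have hL2 : ∫⁻ x, ‖u₀ x‖ₑ ^ 2 < ⊤ := by
    refine lt_of_le_of_lt (le_of_eq (lintegral_congr fun x => ?_)) (hHk 0)
    rw [← ofReal_norm, ← ofReal_norm, norm_iteratedFDeriv_zero]
  have hu2 : MemLp u₀ 2 volume := ⟨hmeas0, eLpNorm_two_lt_top_of_lintegral_enorm_sq_lt_top hL2⟩
  obtain ⟨C₀, hC₀⟩ := hdec 0 0
  have hbd0 : ∀ x, ‖u₀ x‖ ≤ C₀ := fun x => by
    have h := hC₀ x
    rwa [pow_zero, one_mul, norm_iteratedFDeriv_zero] at h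
  have hu3 : MemLp u₀ 3 volume := by
    refine ⟨hmeas0, ?_⟩
    have h3 : eLpNorm u₀ 3 volume ^ 3 ≤ eLpNorm u₀ ⊤ volume * eLpNorm u₀ 2 volume ^ 2 :=
      eLpNorm_three_pow_le hmeas0
    have htop : eLpNorm u₀ ⊤ volume ≤ ENNReal.ofReal C₀ := eLpNorm_top_le_of_bound hbd0
    have hfin : eLpNorm u₀ ⊤ volume * eLpNorm u₀ 2 volume ^ 2 < ⊤ :=
      ENNReal.mul_lt_top (htop.trans_lt ENNReal.ofReal_lt_top)
        (ENNReal.pow_lt_top hu2.eLpNorm_lt_top)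
    by_contra hnot
    rw [not_lt, top_le_iff] at hnot
    rw [hnot, ENNReal.top_pow (by norm_num)] at h3
    exact absurd (h3.trans_lt hfin) (lt_irrefl _)
  exact ⟨hu2, hu3, VectorCalculus.IsDivFree.isWeaklyDivFree_holds hdiv (hsm.of_le (mod_cast le_top))⟩

/-- **A Tao-class solution and a Leray–Hopf classical solution from the same datum coincide.** If
`U` is a Tao-class solution on `[0, t']` from `u 0`, and `u` is classical on `[0, T)`, `t' < T`, and
Leray–Hopf on `[0, T]` from `u 0`, then `U s = u s` for every `s ∈ [0, t']`: a.e. on each slice by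
Prodi–Serrin weak–strong uniqueness (`U` is bounded, hence in the Serrin class `L^∞_t L^∞_x`;
`weak_strong_uniqueness_holds`), and everywhere by continuity of both slices.
[cite: RobinsonRodrigoSadowski2016, Thm. 8.19] -/
theorem amplificationOf_tao_eq {ν T : ℝ} (hν : 0 < ν) {u : ℝ → ℝ³ → ℝ³} {p : ℝ → ℝ³ → ℝ}
    (hcl : IsClassicalNSSolutionOn (Ico 0 T) ν 0 u p) (hLH : IsLerayHopfOn T ν 0 (u 0) u)
    {t' : ℝ} (ht'0 : 0 < t') (ht'T : t' < T) {U : ℝ → ℝ³ → ℝ³} {P : ℝ → ℝ³ → ℝ}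
    (hU : IsTaoSolutionOn t' ν (u 0) U P) : ∀ s ∈ Icc 0 t', U s = u s := by
  intro s hs
  rcases eq_or_lt_of_le hs.1 with h0 | hs0
  · subst h0; exact hU.initial
  have hLHU : IsLerayHopfOn t' ν 0 (u 0) U := hU.isLerayHopfOn ht'0
  obtain ⟨B, -, hB⟩ := hU.exists_bound_velocity
  have hSer : MemLqLp ⊤ ⊤ U (Ioo 0 t') :=
    memLqLp_top_top_of_bound (fun r hr => hU.aestronglyMeasurable_slice hr) hB
  have hLHu : IsLerayHopfOn t' ν 0 (u 0) u := IsLerayHopfOn.mono_holds hLH ht'T.le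
  have hae : u s =ᵐ[volume] U s :=
    weak_strong_uniqueness_holds hν ht'0 hLHU (q := ⊤) (r := ⊤) ENNReal.ofNat_lt_top
      (by simp [ENNReal.div_top]) hSer hLHu s ⟨hs0, hs.2⟩
  have hcu : Continuous (u s) := (hcl.contDiff_velocity ⟨hs.1, hs.2.trans_lt ht'T⟩).continuous
  have hcU : Continuous (U s) := (hU.classical.contDiff_velocity hs).continuous
  exact (hcU.ae_eq_iff_eq (μ := volume) hcu).1 hae.symm

/-- **The Kato maximal time of a maximal Leray–Hopf classical solution is at least its lifespan.**
Let `(u, p)` be a maximal smooth solution on `[0, T)` (`T > 0`, `ν > 0`), Leray–Hopf on `[0, T]`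
from the rapidly decaying datum `u 0`. Then `T ≤ T_max(u 0)` (Kato's maximal time in `C_t L³_x`):
were `T_max < T`, the maximal Kato solution `w` on `[0, T_max)` would have a singular point
`(T_max, x₁)` (Lemarié-Rieusset 2016, Thm. 15.1 (C), `lemarieRieusset_singular_point_of_blowup_holds`)
— but `w` agrees a.e. with `u` on every slice of `(0, T_max)` (through the Tao-class upgrades of
`w` below `T_max`, von Wahl, and Prodi–Serrin), and `u` is jointly smooth on `[0, T) × ℝ³`, hence
bounded on a cylinder `Q_r(T_max, x₁)` since `T_max < T` — contradiction.
[cite: LemarieRieusset2016, Thm. 15.1 (C)] -/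
theorem ofReal_le_katoMaximalTime_of_isMaximalSmoothSolution {ν T : ℝ} (hν : 0 < ν) (hT : 0 < T)
    {u : ℝ → ℝ³ → ℝ³} {p : ℝ → ℝ³ → ℝ} (hmax : IsMaximalSmoothSolution ν 0 u p T)
    (hLH : IsLerayHopfOn T ν 0 (u 0) u) (hdec : HasRapidSpatialDecay (u 0)) :
    ENNReal.ofReal T ≤ katoMaximalTime ν (u 0) := by
  classical
  have h0T : (0 : ℝ) ∈ Ico 0 T := ⟨le_rfl, hT⟩
  have hsm : ContDiff ℝ ∞ (u 0) := hmax.1.contDiff_velocity h0T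
  have hdiv : VectorCalculus.IsDivFree (u 0) := hmax.1.divFree 0 h0T
  have hdivW : NSWave0.IsDivFree (u 0) := fun x => hdiv x
  obtain ⟨-, hu3, hwdiv⟩ := amplificationOf_datum hsm hdiv hdec
  have hTm0 : 0 < katoMaximalTime ν (u 0) := katoMaximalTime_pos kato_local_holds hν hu3 hwdiv
  by_contra hlt
  rw [not_le] at hlt
  have htop' : katoMaximalTime ν (u 0) < ⊤ := hlt.trans_le le_top
  -- the maximal Kato solution `w` on `[0, Tm)`, `Tm = T_max < T`
  obtain ⟨w, hw⟩ := exists_isKatoSolutionOn_katoMaximalTime kato_unique_holds hν hTm0 htop'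
  set Tm : ℝ := (katoMaximalTime ν (u 0)).toReal with hTm_def
  have hT0 : 0 < Tm := ENNReal.toReal_pos hTm0.ne' htop'.ne
  have hofReal : ENNReal.ofReal Tm = katoMaximalTime ν (u 0) := ENNReal.ofReal_toReal htop'.ne
  have hTmT : Tm < T := by
    have h : ENNReal.ofReal Tm < ENNReal.ofReal T := by rw [hofReal]; exact hlt
    exact (ENNReal.ofReal_lt_ofReal_iff'.1 h).1
  have hmaxK : ∀ T'' : ℝ, Tm < T'' → ∀ w' : ℝ → ℝ³ → ℝ³, ¬ IsKatoSolutionOn T'' ν (u 0) w' :=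
    fun T'' hT'' w' => not_isKatoSolutionOn_of_katoMaximalTime_lt (by
      rw [← hofReal]
      exact (ENNReal.ofReal_lt_ofReal_iff (hT0.trans hT'')).2 hT'')
  -- its singular point `(Tm, x₁)`
  obtain ⟨x₁, hx₁⟩ := lemarieRieusset_singular_point_of_blowup_holds hν hT0 hu3 hwdiv hw hmaxK
  have hall : ∀ r : ℝ, 0 < r →
      eLpNorm (uncurry w) ⊤ (volume.restrict (parabolicCylinder r ((Tm : ℝ), x₁))) = ⊤ :=
    fun r hr => eLpNorm_top_parabolicCylinder_eq_top_of_small hT0 hx₁ hr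
  -- `u` agrees a.e. with `w` on every slice of `(0, Tm)`
  have huw : ∀ t ∈ Ioo 0 Tm, u t =ᵐ[volume] w t := by
    intro t ht
    set t' : ℝ := (t + Tm) / 2 with ht'_def
    have htt' : t < t' := by rw [ht'_def]; linarith [ht.2]
    have ht'Tm : t' < Tm := by rw [ht'_def]; linarith [ht.2]
    have ht'0 : 0 < t' := ht.1.trans htt'
    obtain ⟨U, P, hU⟩ :=
      exists_isTaoSolutionOn_of_isKatoSolutionOn hν hsm hdivW hdec hw ht'0 ht'Tm
    have hwt' : IsKatoSolutionOn t' ν (u 0) w := hw.mono ht'Tm.le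
    have h1 : U t =ᵐ[volume] w t :=
      hU.ae_eq_of_kato hν hwt'.mild hwt'.continuousInLpOn hwt'.aestronglyMeasurable t
        ⟨ht.1.le, htt'⟩
    have h2 : U t = u t :=
      amplificationOf_tao_eq hν hmax.1 hLH ht'0 (ht'Tm.trans hTmT) hU t ⟨ht.1.le, htt'.le⟩
    rw [← h2]
    exact h1
  have hum : AEStronglyMeasurable (uncurry u) (volume.restrict (Ioo 0 Tm ×ˢ univ)) :=
    (hmax.1.smooth_velocity.continuousOn.mono
      (prod_mono (fun t ht => ⟨ht.1.le, ht.2.trans hTmT⟩) Subset.rfl)).aestronglyMeasurable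
      (measurableSet_Ioo.prod MeasurableSet.univ)
  -- `u` is bounded on the compact `[Tm/2, Tm] × B̄(x₁, 1) ⊆ [0, T) × ℝ³`
  set K : Set (ℝ × ℝ³) := Icc (Tm / 2) Tm ×ˢ closedBall x₁ 1 with hK_def
  have hK : IsCompact K := isCompact_Icc.prod (isCompact_closedBall _ _)
  have hKsub : K ⊆ Ico 0 T ×ˢ (univ : Set ℝ³) :=
    prod_mono (fun t ht => ⟨by linarith [ht.1], ht.2.trans_lt hTmT⟩) (subset_univ _)
  have hcont : ContinuousOn (uncurry u) K := hmax.1.smooth_velocity.continuousOn.mono hKsub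
  obtain ⟨M, hM⟩ := hK.exists_bound_of_continuousOn hcont
  set r : ℝ := min 1 (Real.sqrt (Tm / 2)) with hr_def
  have hr0 : 0 < r := lt_min one_pos (Real.sqrt_pos.2 (by positivity))
  have hr1 : r ≤ 1 := min_le_left _ _
  have hr2 : r ^ 2 ≤ Tm / 2 := by
    calc r ^ 2 ≤ Real.sqrt (Tm / 2) ^ 2 := pow_le_pow_left₀ hr0.le (min_le_right _ _) 2
      _ = Tm / 2 := Real.sq_sqrt (by positivity)
  have hcylK : parabolicCylinder r ((Tm : ℝ), x₁) ⊆ K := by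
    rintro ⟨s, y⟩ hz
    rw [mem_parabolicCylinder] at hz
    exact ⟨⟨by linarith [hz.1.1], hz.1.2.le⟩, mem_closedBall.2 (hz.2.le.trans hr1)⟩
  have hbdu : eLpNorm (uncurry u) ⊤ (volume.restrict (parabolicCylinder r ((Tm : ℝ), x₁))) < ⊤ := by
    rw [eLpNorm_exponent_top]
    refine eLpNormEssSup_lt_top_of_ae_bound (C := M) ?_
    filter_upwards [ae_restrict_mem (isOpen_parabolicCylinder r ((Tm : ℝ), x₁)).measurableSet]
      with z hz
    exact hM _ (hcylK hz)
  -- … while the singularity of `w` at `(Tm, x₁)` transfers to `u`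
  have huw' : uncurry u =ᵐ[volume.restrict (Ioo 0 Tm ×ˢ (univ : Set ℝ³))] uncurry w :=
    ae_restrict_prod_of_forall_ae_eq huw hum hw.aestronglyMeasurable
  exact hbdu.ne (eLpNorm_parabolicCylinder_eq_top_of_ae_eq hT0 huw' x₁ hall hr0)

/-- **Tao-class solutions below the lifespan of a maximal Leray–Hopf classical solution.** In the
setting of `ofReal_le_katoMaximalTime_of_isMaximalSmoothSolution`, for every `0 < t < T` the datum
`u 0` has a Tao-class solution `(U, P)` on the closed slab `[0, t]` (a Kato solution lives on some
`[0, T')`, `T' > t`, since `t < T ≤ T_max(u 0)`, and upgrades to Tao's class on `[0, t]` by von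
Wahl's regularity of `C_t L³_x`, `exists_isTaoSolutionOn_of_isKatoSolutionOn`), and `U = u` on
`[0, t]` (`amplificationOf_tao_eq`). [cite: LemarieRieusset2016, Thm. 7.2 and Prop. 12.3] -/
theorem exists_isTaoSolutionOn_of_isMaximalSmoothSolution {ν T : ℝ} (hν : 0 < ν) (hT : 0 < T)
    {u : ℝ → ℝ³ → ℝ³} {p : ℝ → ℝ³ → ℝ} (hmax : IsMaximalSmoothSolution ν 0 u p T)
    (hLH : IsLerayHopfOn T ν 0 (u 0) u) (hdec : HasRapidSpatialDecay (u 0)) {t : ℝ}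
    (ht0 : 0 < t) (htT : t < T) :
    ∃ (U : ℝ → ℝ³ → ℝ³) (P : ℝ → ℝ³ → ℝ), IsTaoSolutionOn t ν (u 0) U P ∧
      ∀ s ∈ Icc 0 t, U s = u s := by
  have h0T : (0 : ℝ) ∈ Ico 0 T := ⟨le_rfl, hT⟩
  have hsm : ContDiff ℝ ∞ (u 0) := hmax.1.contDiff_velocity h0T
  have hdiv : VectorCalculus.IsDivFree (u 0) := hmax.1.divFree 0 h0T
  have hdivW : NSWave0.IsDivFree (u 0) := fun x => hdiv x
  have hle := ofReal_le_katoMaximalTime_of_isMaximalSmoothSolution hν hT hmax hLH hdec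
  have hlt : ENNReal.ofReal t < katoMaximalTime ν (u 0) :=
    lt_of_lt_of_le ((ENNReal.ofReal_lt_ofReal_iff hT).2 htT) hle
  obtain ⟨T', htT', w, hw⟩ := exists_isKatoSolutionOn_of_lt_katoMaximalTime hlt
  have htT'' : t < T' := (ENNReal.ofReal_lt_ofReal_iff'.1 htT').1
  obtain ⟨U, P, hU⟩ := exists_isTaoSolutionOn_of_isKatoSolutionOn hν hsm hdivW hdec hw ht0 htT''
  exact ⟨U, P, hU, amplificationOf_tao_eq hν hmax.1 hLH ht0 htT hU⟩

/-- **The enstrophy blows up at the lifespan of a maximal Leray–Hopf classical solution.** In the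
setting of `ofReal_le_katoMaximalTime_of_isMaximalSmoothSolution`, `∫ ‖∇u(t)‖²` exceeds every level
at some `t ∈ [0, T)`: otherwise, the energy being bounded by the Leray–Hopf energy inequality and the
solution having all Sobolev norms bounded on every closed sub-slab (it is Tao-class there,
`exists_isTaoSolutionOn_of_isMaximalSmoothSolution`), the `H¹` continuation criterion
`hasSobolevExtensionPast_of_uniform_H1_bound` (Constantin–Fefferman; Lemarié-Rieusset 2016, proof of
Thm. 11.7) would continue `u` in the Beale–Kato–Majda class past `T`, contradicting maximality.
[cite: LemarieRieusset2016, Thm. 11.7 (proof, PDF p. 369)] -/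
theorem exists_enstrophy_gt_of_isMaximalSmoothSolution :
    ∀ {ν T : ℝ}, 0 < ν → 0 < T →
      ∀ {u : ℝ → EuclideanSpace ℝ (Fin 3) → EuclideanSpace ℝ (Fin 3)}
        {p : ℝ → EuclideanSpace ℝ (Fin 3) → ℝ}, IsMaximalSmoothSolution ν 0 u p T →
        IsLerayHopfOn T ν 0 (u 0) u → HasRapidSpatialDecay (u 0) →
        ∀ M : ℝ, ∃ t ∈ Set.Ico 0 T, ENNReal.ofReal M < ∫⁻ x, ‖fderiv ℝ (u t) x‖ₑ ^ 2 := by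
  intro ν T hν hT u p hmax hLH hdec M
  by_contra hcon
  push Not at hcon
  -- energy and enstrophy bounds on `[0, T)`
  have hE : ∀ t ∈ Ico 0 T,
      ∫⁻ x, ‖u t x‖ₑ ^ 2 ≤ ENNReal.ofReal (2 * VectorCalculus.kineticEnergy (u 0)) :=
    fun t ht => hLH.lintegral_enorm_sq_le hν.le ⟨ht.1, ht.2.le⟩
  set A : ℝ := 2 * VectorCalculus.kineticEnergy (u 0) + 3 * max M 0 with hA_def
  have hkin : 0 ≤ VectorCalculus.kineticEnergy (u 0) := kineticEnergy_nonneg _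
  have hA0 : 0 ≤ A := by positivity
  have hA : ∀ t ∈ Ico 0 T, (∫⁻ x, ‖u t x‖ₑ ^ 2) +
      (∫⁻ x, ENNReal.ofReal (frobeniusNormSq (fderiv ℝ (u t) x))) ≤ ENNReal.ofReal A := by
    intro t ht
    have h2 : (∫⁻ x, ENNReal.ofReal (frobeniusNormSq (fderiv ℝ (u t) x))) ≤
        3 * ∫⁻ x, ‖fderiv ℝ (u t) x‖ₑ ^ 2 := by
      calc (∫⁻ x, ENNReal.ofReal (frobeniusNormSq (fderiv ℝ (u t) x)))
          ≤ ∫⁻ x, 3 * ‖fderiv ℝ (u t) x‖ₑ ^ 2 :=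
            lintegral_mono fun x => ofReal_frobeniusNormSq_le_three_mul_enorm_sq _
        _ = 3 * ∫⁻ x, ‖fderiv ℝ (u t) x‖ₑ ^ 2 := lintegral_const_mul' _ _ (by norm_num)
    have h3 : ∫⁻ x, ‖fderiv ℝ (u t) x‖ₑ ^ 2 ≤ ENNReal.ofReal (max M 0) :=
      (hcon t ht).trans (ENNReal.ofReal_le_ofReal (le_max_left _ _))
    calc (∫⁻ x, ‖u t x‖ₑ ^ 2) + (∫⁻ x, ENNReal.ofReal (frobeniusNormSq (fderiv ℝ (u t) x)))
        ≤ ENNReal.ofReal (2 * VectorCalculus.kineticEnergy (u 0)) + 3 * ENNReal.ofReal (max M 0) :=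
          add_le_add (hE t ht) (h2.trans (by gcongr))
      _ = ENNReal.ofReal A := by
          rw [hA_def, ENNReal.ofReal_add (by positivity) (by positivity),
            ENNReal.ofReal_mul (by norm_num : (0 : ℝ) ≤ 3), ENNReal.ofReal_ofNat]
  -- Sobolev regularity on closed sub-slabs: `u` is Tao-class there
  have hreg : ∀ T'' < T, HasBoundedSobolevNormsOn (Icc 0 T'') u := by
    intro T'' hT''
    set t : ℝ := max T'' (T / 2) with ht_def
    have ht0 : 0 < t := lt_max_of_lt_right (half_pos hT)
    have htT : t < T := max_lt hT'' (half_lt_self hT)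
    obtain ⟨U, P, hU, hUeq⟩ :=
      exists_isTaoSolutionOn_of_isMaximalSmoothSolution hν hT hmax hLH hdec ht0 htT
    intro n
    obtain ⟨C, hC⟩ := hU.sobolev n
    refine ⟨C, fun s hs => ?_⟩
    have hs' : s ∈ Icc 0 t := ⟨hs.1, hs.2.trans (le_max_left _ _)⟩
    rw [← hUeq s hs']
    exact hC s hs'
  have hext := hasSobolevExtensionPast_of_uniform_H1_bound hν hT hmax.1 hreg hA0 hA
  exact hmax.2 hext.hasSmoothExtensionPast

end Summit.NavierStokesRegularity.NavierStokesRegularity.Theorems.CertifiedBlowupAxisymBlowup.CompactAmplification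

end
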